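import Summits.HubbardSuperconductivity.HubbardSuperconductivity.Theses.SignStructure
import Literature.MathematicalPhysics.QuantumLattice.SlaterPairAnnihilatorBounds
import Literature.MathematicalPhysics.QuantumLattice.SlaterStateUnitaryReduction

/-!
# Route `SignStructure`, support `SlaterRankBound` (stmt-HubbardSuperconductivity-2140) — assembly

**Slater rank bound** (Yang 1962 §3 / Coleman 1963): for a superposition `ψ = Σ_{a<m} α_a Φ_a` of
Slater states `Φ_a` of PRODUCT orbitals (unnormalised, not necessarily orthogonal),

  `Re v† ρ₂(ψ) v ≤ 2 (Σ_a |α_a| ‖Φ_a‖)² ‖v‖²`,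

i.e. the largest eigenvalue of Yang's `ρ₂` of a single Slater determinant is at most `2‖Φ‖²`.
Assembly of the Literature files `SlaterPairAnnihilatorBounds` (A) and
`SlaterStateUnitaryReduction` (B): `v†ρ₂(ψ)v = ‖P_v ψ‖²` (Yang's identity, tree), each
`Φ_a = c_a Γ(U_a)|T_a⟩` (part B), `P_v Γ(U) = Γ(U) P_{Uᵀ v U}` with `‖Uᵀ v U‖ = ‖v‖` and `Γ(U)`
unitary, `‖P_w |T⟩‖² ≤ 2‖w‖²` (part A), and the triangle inequality in `ℓ²(𝒫 ι)`.

Sources: C. N. Yang, Rev. Mod. Phys. 34 (1962) 694, §3; A. J. Coleman, Rev. Mod. Phys. 35 (1963)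
668. No definition is introduced.
-/

set_option linter.dupNamespace false

namespace Summit.HubbardSuperconductivity.HubbardSuperconductivity.Theorems.SignStructure

open Matrix Finset
open Literature.MathematicalPhysics.QuantumLattice
open Literature.MathematicalPhysics.QuantumLattice.RayleighBound
open Summit.HubbardSuperconductivity.HubbardSuperconductivity.Theses.SignStructure

variable {ι : Type*} [LinearOrder ι] [Fintype ι]

/-! ### Norm bookkeeping -/

omit [LinearOrder ι] [Fintype ι] in
/-- `Re Σ_p star(w p) w p = Σ_p |w p|²`. [folklore] -/
theorem re_star_dotProduct_self {κ : Type*} [Fintype κ] (w : κ → ℂ) :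
    (star w ⬝ᵥ w).re = ∑ p, ‖w p‖ ^ 2 := by
  rw [dotProduct, Complex.re_sum]
  refine Finset.sum_congr rfl fun p _ => ?_
  rw [Pi.star_apply, Complex.star_def, Complex.conj_mul', ← Complex.ofReal_pow, Complex.ofReal_re]

/-- A unitary matrix preserves the norm of a Fock vector. [folklore] -/
theorem normSq_unitary_mulVec {W : Matrix (Finset ι) (Finset ι) ℂ}
    (hW : W ∈ Matrix.unitaryGroup (Finset ι) ℂ) (x : Fock ι) : normSq (W *ᵥ x) = normSq x := by
  have h : star (W *ᵥ x) ⬝ᵥ (W *ᵥ x) = star x ⬝ᵥ x := by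
    rw [star_mulVec_dotProduct, mulVec_mulVec, ← star_eq_conjTranspose,
      Matrix.mem_unitaryGroup_iff'.1 hW, one_mulVec]
  rw [star_dotProduct_self_eq_normSq, star_dotProduct_self_eq_normSq] at h
  exact_mod_cast h

/-- `‖ |T⟩ ‖² = 1`. [folklore] -/
theorem normSq_single (T : Finset ι) : normSq (Pi.single T (1 : ℂ) : Fock ι) = 1 := by
  rw [normSq, Finset.sum_eq_single T]
  · rw [Pi.single_eq_same, norm_one, one_pow]
  · intro S _ hS
    rw [Pi.single_eq_of_ne hS, norm_zero, zero_pow two_ne_zero]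
  · exact fun h => absurd (Finset.mem_univ T) h

/-! ### The bound for one Slater state -/

/-- **`‖P_v Φ‖² ≤ 2 ‖v‖² ‖Φ‖²` for every Slater state `Φ = c†(φ₀)⋯c†(φ_{N-1})|∅⟩`** of arbitrary
orbitals. [cite: Yang1962, §3] -/
theorem normSq_pairAnnihilator_slater_le {N : ℕ} (φ : Fin N → ι → ℂ) (v : ι × ι → ℂ) :
    normSq (pairAnnihilator v *ᵥ ((List.ofFn fun k => create (φ k)).prod *ᵥ (vacuum : Fock ι))) ≤
      2 * (star v ⬝ᵥ v).re *
        normSq ((List.ofFn fun k => create (φ k)).prod *ᵥ (vacuum : Fock ι)) := by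
  obtain ⟨U, hU, c, T, hΦ⟩ := exists_unitary_smul_Gamma_single φ
  set v' : ι × ι → ℂ := fun q => ∑ p : ι × ι, U p.1 q.1 * v p * U p.2 q.2 with hv'
  have hGU : Gamma U ∈ Matrix.unitaryGroup (Finset ι) ℂ := Gamma_mem_unitaryGroup hU
  have h1 : pairAnnihilator v *ᵥ ((List.ofFn fun k => create (φ k)).prod *ᵥ (vacuum : Fock ι)) =
      c • (Gamma U *ᵥ (pairAnnihilator v' *ᵥ (Pi.single T (1 : ℂ) : Fock ι))) := by
    rw [hΦ, mulVec_smul, mulVec_mulVec, pairAnnihilator_mul_Gamma, ← mulVec_mulVec]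
  have h2 : normSq ((List.ofFn fun k => create (φ k)).prod *ᵥ (vacuum : Fock ι)) = ‖c‖ ^ 2 := by
    rw [hΦ, normSq_smul, normSq_unitary_mulVec hGU, normSq_single, mul_one]
  have hvv : (star v ⬝ᵥ v).re = ∑ p, ‖v' p‖ ^ 2 := by
    rw [← re_star_dotProduct_self, hv', star_dotProduct_pairMap_self hU]
  rw [h1, h2, normSq_smul, normSq_unitary_mulVec hGU, hvv]
  have hc : 0 ≤ ‖c‖ ^ 2 := by positivity
  nlinarith [normSq_pairAnnihilator_single_le v' T, hc,
    mul_le_mul_of_nonneg_left (normSq_pairAnnihilator_single_le v' T) hc]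

/-! ### The Slater rank bound -/

/-- **`SlaterRankBound` holds** (route `SignStructure`, support item
`stmt-HubbardSuperconductivity-2140`): for `ψ = Σ_a α_a Φ_a` with `Φ_a` Slater states of product
orbitals, `Re v†ρ₂(ψ)v ≤ 2 (Σ_a |α_a| ‖Φ_a‖)² ‖v‖²`. [cite: Yang1962, §3] -/
theorem slaterRankBound_proof : SlaterRankBound := by
  intro ι _ _ m N α φ v
  -- the Slater states and Yang's identity `v†ρ₂v = ‖P_v ψ‖²`
  set Φ : Fin m → Fock ι := fun a =>
    FirstQuant.slater (fun o : Fin N → ι => ∏ k, φ a k (o k)) with hΦ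
  have hΦprod : ∀ a, Φ a = (List.ofFn fun k => create (φ a k)).prod *ᵥ (vacuum : Fock ι) :=
    fun a => slater_prod_eq (φ a)
  set ψ : Fock ι := ∑ a, α a • Φ a with hψ
  have hyang : star v ⬝ᵥ (twoParticleRDM ψ *ᵥ v) = star (pairAnnihilator v *ᵥ ψ) ⬝ᵥ (pairAnnihilator v *ᵥ ψ) := by
    rw [← expect_pairAnnihilator_conjTranspose_mul_holds v ψ, Literature.MathematicalPhysics.QuantumLattice.expect,
      ← mulVec_mulVec,
      star_mulVec_dotProduct]
  -- pass to the Euclidean norm on `ℓ²(𝒫 ι)`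
  have hnorm : ∀ x : Fock ι, ‖(WithLp.toLp 2 x : EuclideanSpace ℂ (Finset ι))‖ ^ 2 = normSq x := by
    intro x
    rw [EuclideanSpace.norm_sq_eq, normSq]
  have hnorm' : ∀ x : Fock ι, ‖(WithLp.toLp 2 x : EuclideanSpace ℂ (Finset ι))‖ = Real.sqrt (normSq x) := by
    intro x
    rw [← hnorm, Real.sqrt_sq (norm_nonneg _)]
  have hLHS : (star v ⬝ᵥ (twoParticleRDM ψ *ᵥ v)).re =
      ‖(WithLp.toLp 2 (pairAnnihilator v *ᵥ ψ) : EuclideanSpace ℂ (Finset ι))‖ ^ 2 := by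
    rw [hyang, star_dotProduct_self_eq_normSq, Complex.ofReal_re, hnorm]
  -- each Slater state: `‖P_v Φ_a‖ ≤ √2 ‖v‖ ‖Φ_a‖`
  have hone : ∀ a, ‖(WithLp.toLp 2 (pairAnnihilator v *ᵥ Φ a) : EuclideanSpace ℂ (Finset ι))‖ ≤
      Real.sqrt 2 * Real.sqrt ((star v ⬝ᵥ v).re) * Real.sqrt ((star (Φ a) ⬝ᵥ Φ a).re) := by
    intro a
    rw [hnorm', star_dotProduct_self_eq_normSq, Complex.ofReal_re, ← Real.sqrt_mul (by norm_num),
      ← Real.sqrt_mul (mul_nonneg (by norm_num) ?_)]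
    · apply Real.sqrt_le_sqrt
      rw [hΦprod]
      exact normSq_pairAnnihilator_slater_le (φ a) v
    · rw [re_star_dotProduct_self]
      exact Finset.sum_nonneg fun p _ => by positivity
  -- triangle inequality
  have htri : ‖(WithLp.toLp 2 (pairAnnihilator v *ᵥ ψ) : EuclideanSpace ℂ (Finset ι))‖ ≤
      ∑ a, ‖α a‖ * (Real.sqrt 2 * Real.sqrt ((star v ⬝ᵥ v).re) * Real.sqrt ((star (Φ a) ⬝ᵥ Φ a).re)) := by
    rw [hψ, Matrix.mulVec_sum, WithLp.toLp_sum]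
    refine (norm_sum_le _ _).trans (Finset.sum_le_sum fun a _ => ?_)
    rw [mulVec_smul, WithLp.toLp_smul, norm_smul]
    exact mul_le_mul_of_nonneg_left (hone a) (norm_nonneg _)
  have hsum_eq : ∑ a, ‖α a‖ * (Real.sqrt 2 * Real.sqrt ((star v ⬝ᵥ v).re) *
      Real.sqrt ((star (Φ a) ⬝ᵥ Φ a).re)) =
      Real.sqrt 2 * Real.sqrt ((star v ⬝ᵥ v).re) *
        ∑ a, ‖α a‖ * Real.sqrt ((star (Φ a) ⬝ᵥ Φ a).re) := by
    rw [Finset.mul_sum]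
    refine Finset.sum_congr rfl fun a _ => ?_
    ring
  have hvv : 0 ≤ (star v ⬝ᵥ v).re := by
    rw [re_star_dotProduct_self]
    exact Finset.sum_nonneg fun p _ => by positivity
  have hS : 0 ≤ ∑ a, ‖α a‖ * Real.sqrt ((star (Φ a) ⬝ᵥ Φ a).re) :=
    Finset.sum_nonneg fun a _ => mul_nonneg (norm_nonneg _) (Real.sqrt_nonneg _)
  rw [hsum_eq] at htri
  rw [hLHS]
  calc ‖(WithLp.toLp 2 (pairAnnihilator v *ᵥ ψ) : EuclideanSpace ℂ (Finset ι))‖ ^ 2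
      ≤ (Real.sqrt 2 * Real.sqrt ((star v ⬝ᵥ v).re) *
          ∑ a, ‖α a‖ * Real.sqrt ((star (Φ a) ⬝ᵥ Φ a).re)) ^ 2 := by
        gcongr
    _ = 2 * (∑ a, ‖α a‖ * Real.sqrt ((star (Φ a) ⬝ᵥ Φ a).re)) ^ 2 * (star v ⬝ᵥ v).re := by
        rw [mul_pow, mul_pow, Real.sq_sqrt (by norm_num), Real.sq_sqrt hvv]
        ring

end Summit.HubbardSuperconductivity.HubbardSuperconductivity.Theorems.SignStructure
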